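import Summits.QuantumAdvantage.QuantumAdvantage.Theses.ArithStatLadder
import Literature.NumberTheory.QuadraticFields.ThreeTorsion

/-!
# Disproof attempts on `ArithStatLadder.DigitRung` (crux `stmt-QuantumAdvantage-2423`)

Standing adversary file (refuter `cdisprove`, cycle 1, 2026-08-16). Prose lives in docstrings;
everything not marked `sorry` is kernel-checked.

## Findings so far

* §1 `digitRung_iff`, `digitRung_iff_canonical` — the crux quantifies over every statistic `t`
  pinned to `#Cl(K)[3]` on quadratic fields; it is EQUIVALENT to its instance at the tree's total
  function `quadFieldThreeTorsion` (all sums run over fundamental `−d`, where every pinned `t`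
  agrees with it). So there is exactly one statement to attack / prove; the `∀ t` is harmless
  (not vacuous: `pins_canonical`).
* §2 `digitRung_false_without_pins` — LOAD-BEARING: drop the pinning hypothesis and the rung is
  false (`t := 0`, top digit `j = n − 1`, `b = true` selects the whole block; blocks are non-empty
  from `n ≥ 6` by Bertrand: `d = 8p`). Any proof must use the hypothesis at (almost) every `d`.
* §3 `digitRung_implies_dyadicMeanTwo` — the top digit alone already forces the
  Davenport–Heilbronn law "mean of `#Cl₃(−d)` over n-bit fundamental `−d` → 2": DigitRung is at
  least as strong as dyadic DH (in the tree only as the named fact `bst_threeTorsion_mean`, not as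
  a theorem), and it is false for every centring constant other than the DH mean.
* §4 `card_cubicDisc_eq_mul_unit_pow_six` — WHY NO CHEAP 2-ADIC COUNTEREXAMPLE EXISTS: the number of
  binary cubic forms over `ZMod m` with discriminant `r` equals the number with discriminant
  `s⁶·r` for every unit `s` (substitution `(x, y) ↦ (s x, y)`); over `ℤ/2ᵏ` the sixth powers of
  units are exactly the units `≡ 1 (mod 8)`, so discriminant counts (and, the substitution being a
  `GL₂`-change of variables, counts of maximal / nowhere-totally-ramified forms) are constant on
  the classes `a ≡ a₀ (mod 8·2^{v₂(a₀)})` — there is no main-term bias of `#Cl₃` at ANY binary digit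
  depth; a disproof would have to come from a genuine failure of equidistribution of cubic-field
  discriminants in Bohr sets `{bit_j = b}`, `(5/43)n < j < (2/3)n`, for which no mechanism is known.
* §4b `card_cubicDisc_eq_add_two_pow` — the character-free, all-depth form of §4: in any family of
  binary cubic forms over `ℤ/2ᵏ` stable under `(a,b,c,d) ↦ (s²a, sb, c, s⁻¹d)` (which scales `Disc`
  by `s²`; e.g. maximal / nowhere-totally-ramified forms), `#{Disc = a} = #{Disc = a + 2^{k−1}}`
  whenever `k ≥ v₂(a) + 4` (`9^{2^{k−4−v}} ≡ 1 + 2^{k−1−v}`): digit `k−1` of the discriminant is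
  EXACTLY fair 2-adically given the lower digits, at every depth — the singular series of the
  digit-twisted count vanishes identically; no 2-adic counterexample at any digit.
* §5 `concl_iff_total_and_walsh` — the rung is equivalent to "block mean → 2" plus "weight-one
  digital WALSH correlations `Σ (t−2)(−1)^{bit_j} = o(#𝒟_n)` uniformly in `j`" (the `|S| = 1`
  case of AcZeroRung); a disproof = a persistent weight-one Walsh bias. `exists_subset_large_dev` —
  for UNSTRUCTURED test sets the conclusion fails maximally (`#Cl₃ = 3^{r₃} ≠ 2` pointwise gives a
  subset with deviation `≥ #𝒟_n/2` for every `n`): any proof must use the digit structure, and no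
  cardinality-only argument about the halves can work.
* §6 `gcd_six_mul_two_pow_ne_one` — bookkeeping warning: the tree's TT progression fact requires
  `gcd(6a, m) = 1`, which never holds for `m = 2^{j+1}`; the low-digit end is NOT in the tree even
  as a named fact (needs TT's twisted theorem for `4 ∣ m` + the 2-adic computation of §4).
* §7 `model_ends_hold_middle_fails` — INDEPENDENCE OF THE MIDDLE BAND: for every `n` and
  `j ≤ n − 2` a `{1,3}`-valued model statistic has exactly vanishing centred sums on every set not
  involving digit `j` (all residue classes mod `2ᵏ`, `k ≤ j`; all dyadic intervals of length
  `≥ 2^{j+1}`; all Boolean combinations) yet digit-`j` Walsh correlation `= #block`. So the printed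
  ends (AP theorem below, interval theorems above) can never be interpolated into the middle digit;
  a proof needs digit-`j` information itself (the Weyl sums), as the planner says.
* §8 Numerics (evidence-grade, kit job j014094): EXACT `#Cl₃` for all 8.2·10⁷ fundamental
  `−d`, `d < 2^28`, by counting Mathews–Berwick-reduced binary cubic forms (Hasse: `t = 2·#cubic
  fields + 1`; validated 3 ways). Only biases: `walsh(0) = 0.35·X^{−1/6}` (2-adic type, secondary
  term) and a `10⁻³` top-digit interval drift; the middle band `3 ≤ j ≤ n−5` is pure noise
  (`χ² ≈ dof`; `|walsh| ≤ 2·10⁻⁴` at `n = 30`, job j014095). Kill criterion (ii): NO signal.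

Nothing here refutes the crux. See the `## HANDOFF` of the refuter's NOTES.md for the live attack list.

## Adversary's assessment (why it resists; for the provers)

Write `q = 2^{j+1}`, `X = 2^n`, `w_j(d) = (−1)^{bit_j d}` (a square wave of period `q`, Fourier mass
`Σ_r |ĉ_r| ≍ log q` on odd frequencies `r`). By class field theory (BST §8.5)
`t(−d) − 1 = 2·#{cubic fields F : Disc F = −d}`, so (§5) the rung is the statement
`Σ_{F complex cubic, nowhere tot. ram., X/2 ≤ |Disc F| < X} w_j(|Disc F|) = o(X)` uniformly in `j`
(the fundamental-discriminant sum `Σ_{𝒟_n} w_j(d)` is `≪ (√X + q) log² q = o(X)` for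
`2 ≤ j ≤ n − ω(log n)`, elementary, and the extreme digits are the printed local/interval cases).
1. NO LOCAL OBSTRUCTION (§4): the pushforward of the form measure on maximal non-totally-ramified
   cubic `ℤ₂`-algebras under `Disc` is flat on each 2-adic square class at every depth, so the
   singular series of the twisted count `Σ_f e(r Disc f / q)` VANISHES for odd `r`, `q ≥ 2⁷`:
   a counterexample cannot be 2-adic; it would have to be a failure of equidistribution of the
   values of the quartic form `Disc` on Bhargava's fundamental domain at scale `q ∈ (X^{1/4}, X^{2/3})`.
2. GENERIC CANCELLATION IS PREDICTED ACROSS THE WHOLE BAND: in the balanced fundamental domain the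
   coefficient ranges are `a ~ X^{1/4}λ^{-3}, b ~ X^{1/4}λ^{-1}, c ~ X^{1/4}λ, d ~ X^{1/4}λ³`
   (`1 ≤ λ ≪ X^{1/12}`). `Disc` is QUADRATIC in `d` (lead `−27a²`): completing the square gives
   cancellation in the `d`-sum alone while `q/4^{v₂(a)} ≤ (X^{1/4}λ³)^{2−ε}`, i.e. throughout
   `q ≤ X^{1/2−ε}` (planner idea B); `Disc` is CUBIC in `c` (lead `−4a`): two Weyl differencings give
   a saving while `q/ gcd(4ar, q) ≤ (X^{1/4}λ)^{3−ε}`, i.e. throughout `q ≤ X^{3/4−ε}` (planner idea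
   A), which overlaps the interval regime `q ≥ X^{2/3+ε}` (BTT 2023). The refuter sees no regime
   left where a main-term bias could live; the open work is bookkeeping (uniformity over the cusp,
   the maximality sieve moduli `ρ²` composed with `q`, subtraction of reducible forms), not a
   missing phenomenon. VERDICT: very probably TRUE; no disproof line remains except numerics.
   NEAREST PRIOR ART (read 2026-08-16): Taniguchi–Thorne, *Levels of distribution for sieve
   problems in prehomogeneous vector spaces*, Math. Ann. 376 (2020) = arXiv:1707.01850, §4: level
   of distribution `1/2 − ε` for `q ∣ Disc` over SQUAREFREE `q`, binary cubic forms, via Poisson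
   summation `Σ_x Ψ_q(x)φ(x X^{-1/4}) = X Σ_w Ψ̂_q(w) φ̂(w X^{1/4}/q)` (dual box of side `q X^{-1/4}`,
   empty for `q < X^{1/4−η}`) and the exact orbital Fourier transforms of arXiv:1607.07827 — for a
   smoothed UNDERCOUNT of orbits (lower-bound sieve; no cusp). For the digit weight
   `Ψ(x) = e(r Disc x/2ᵏ)` the same Poisson step with square-root size `|Ψ̂| ≲ 2^{-2k}` gives error
   `≍ q⁴/X · X · q^{-2} = q²`, i.e. exactly the barrier `q < X^{1/2}`; past it the dual sum is LONGER
   than the primal one (`(q X^{-1/4})⁴ > X`), so only differencing in a low-degree variable (the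
   cubic variable `c`) can help — this is why the band `X^{1/2} < q < X^{2/3}` is the real content
   of the crux and why nothing in print covers it (prime-power moduli are moreover the deeply
   ramified case the squarefree-`q` literature excludes; there §4b replaces the singular series).
3. RATE TIGHTNESS (informal; not formalisable from the tree's existential secondary constants):
   the negative secondary term `K⁻X^{5/6}` (BST/TT, Roberts) makes `|dev(n, j, b)| ≍ X^{5/6}` at
   the top digits (`j ≥ n − O(1)`: differences of `Y^{5/6}` over dyadic sub-intervals) and at
   `j ∈ {0, 1}` (the 2-adic types have different secondary densities), so NO version of the rung
   with saving `X^{−δ}`, `δ > 1/6`, is true; `o(1)` (as filed) or `X^{−δ}` for small `δ` is the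
   right target. A "suspect-false" numerical signal would be a middle-digit Walsh correlation that
   does NOT decay like `2^{−n/6}` or faster as `n` grows.
-/

noncomputable section

namespace Summit.QuantumAdvantage.QuantumAdvantage.Cruxes.DigitRung.Disproof

set_option linter.dupNamespace false

open scoped Classical
open Filter Finset
open Literature.NumberTheory.QuadraticFields
open Summit.QuantumAdvantage.QuantumAdvantage.Theses.ArithStatLadder (DigitRung)

/-! ## §0 Vocabulary (literal abbreviations of the crux body) -/

/-- `−d` is a fundamental discriminant — the literal predicate of the route file (an `abbrev`, so
that instance search builds the same `Decidable` term as in the route and `digitRung_iff` is `rfl`). -/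
abbrev IsNegFund (d : ℕ) : Prop :=
  ((-(d:ℤ)) % 4 = 1 ∧ Squarefree (-(d:ℤ)) ∧ (-(d:ℤ)) ≠ 1) ∨
    (4 ∣ (-(d:ℤ)) ∧ ((-(d:ℤ)) / 4 % 4 = 2 ∨ (-(d:ℤ)) / 4 % 4 = 3) ∧ Squarefree ((-(d:ℤ)) / 4))

/-- `𝒟_n`: the `n`-bit `d` (i.e. `2^{n-1} ≤ d < 2^n`) with `−d` fundamental. -/
def block (n : ℕ) : Finset ℕ :=
  (Finset.Ico (2 ^ (n - 1)) (2 ^ n)).filter fun d : ℕ => IsNegFund d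

/-- The digit half `{d ∈ 𝒟_n : bit_j(d) = b}`. -/
def half (n j : ℕ) (b : Bool) : Finset ℕ :=
  (block n).filter fun d : ℕ => Nat.testBit d j = b

/-- The centred digit sum `Σ_{d ∈ 𝒟_n, bit_j d = b} (t(−d) − 2)`. -/
def dev (t : ℤ → ℕ) (n j : ℕ) (b : Bool) : ℝ :=
  ∑ d ∈ half n j b, ((t (-(d:ℤ)) : ℝ) - 2)

/-- The pinning hypothesis of the route: `t D = #Cl(K)[3]` for every quadratic field `K` of
discriminant `D`. -/
def Pins (t : ℤ → ℕ) : Prop :=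
  ∀ (D : ℤ) (K : Type) [Field K] [NumberField K], Module.finrank ℚ K = 2 →
    NumberField.discr K = D →
      t D = Nat.card {c : ClassGroup (NumberField.RingOfIntegers K) // c ^ 3 = 1}

/-- The conclusion of the rung for a given statistic `t`. -/
def Concl (t : ℤ → ℕ) : Prop :=
  ∀ ε : ℝ, 0 < ε → ∀ᶠ n : ℕ in atTop, ∀ j < n, ∀ b : Bool,
    |dev t n j b| ≤ ε * ((block n).card : ℝ)

/-- The crux, literally, is `∀ t, Pins t → Concl t`. [folklore] -/
theorem digitRung_iff : DigitRung ↔ ∀ t : ℤ → ℕ, Pins t → Concl t := Iff.rfl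

/-! ## §1 Reduction to the canonical statistic `quadFieldThreeTorsion` -/

/-- The tree's total function `quadFieldThreeTorsion` is pinned (ThreeTorsion.lean). [folklore] -/
theorem pins_canonical : Pins quadFieldThreeTorsion :=
  fun D K _ _ h2 hD => quadFieldThreeTorsion_eq D K h2 hD

/-- A pinned statistic agrees with `quadFieldThreeTorsion` at every fundamental `−d`
(a quadratic field of that discriminant exists: `Quadratic.exists_numberField_discr_eq`). [folklore] -/
theorem Pins.apply_eq {t : ℤ → ℕ} (ht : Pins t) {d : ℕ} (hd : IsNegFund d) :
    t (-(d:ℤ)) = quadFieldThreeTorsion (-(d:ℤ)) := by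
  obtain ⟨K, _, _, h2, hdisc⟩ := Quadratic.exists_numberField_discr_eq hd
  rw [ht _ K h2 hdisc, quadFieldThreeTorsion_eq _ K h2 hdisc]

/-- Membership in `block n`, unfolded. [folklore] -/
theorem mem_block {n d : ℕ} : d ∈ block n ↔ (2 ^ (n - 1) ≤ d ∧ d < 2 ^ n) ∧ IsNegFund d := by
  simp [block]

/-- Membership in `half n j b`, unfolded. [folklore] -/
theorem mem_half {n j d : ℕ} {b : Bool} :
    d ∈ half n j b ↔ d ∈ block n ∧ Nat.testBit d j = b := by
  simp [half]

/-- On every digit half, a pinned statistic has the same centred sum as the canonical one. [folklore] -/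
theorem Pins.dev_eq {t : ℤ → ℕ} (ht : Pins t) (n j : ℕ) (b : Bool) :
    dev t n j b = dev quadFieldThreeTorsion n j b := by
  unfold dev
  refine Finset.sum_congr rfl fun d hd => ?_
  rw [ht.apply_eq (mem_block.mp (mem_half.mp hd).1).2]

/-- **Reduction.** `DigitRung` is equivalent to its single instance at `quadFieldThreeTorsion`:
the `∀ t` of the crux is bookkeeping, neither a weakening nor a source of vacuity. [folklore] -/
theorem digitRung_iff_canonical : DigitRung ↔ Concl quadFieldThreeTorsion := by
  rw [digitRung_iff]
  refine ⟨fun h => h _ pins_canonical, fun h t ht ε hε => ?_⟩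
  filter_upwards [h ε hε] with n hn j hj b
  rw [ht.dev_eq]
  exact hn j hj b

/-! ## §2 Load-bearing hypothesis: without pinning the rung is false -/

/-- The crux with the pinning hypothesis dropped. -/
def DigitRungWithoutPins : Prop := ∀ t : ℤ → ℕ, Concl t

/-- `−8p` is a fundamental discriminant for every odd prime `p`. [folklore] -/
theorem isNegFund_eight_mul {p : ℕ} (hp : p.Prime) (hp2 : p ≠ 2) : IsNegFund (8 * p) := by
  right
  have hodd : Odd p := hp.odd_of_ne_two hp2
  have hdiv : (-((8 * p : ℕ) : ℤ)) / 4 = -(2 * p) := by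
    rw [show (-((8 * p : ℕ) : ℤ)) = 4 * (-(2 * p)) by push_cast; ring]
    exact Int.mul_ediv_cancel_left _ (by norm_num)
  refine ⟨⟨-(2 * p), by push_cast; ring⟩, ?_, ?_⟩
  · left
    rw [hdiv]
    obtain ⟨k, hk⟩ := hodd
    subst hk
    push_cast
    omega
  · rw [hdiv, ← Int.squarefree_natAbs,
      show (-(2 * (p : ℤ))).natAbs = 2 * p by simp [Int.natAbs_mul]]
    exact (Nat.squarefree_mul (Nat.coprime_two_left.mpr hodd)).mpr
      ⟨Nat.prime_two.prime.squarefree, hp.prime.squarefree⟩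

/-- Blocks are non-empty from `n = 6` on: Bertrand gives a prime `2^{n-4} < p ≤ 2^{n-3}`
(necessarily `< 2^{n-3}` and odd), and `d = 8p` is an `n`-bit number with `−d` fundamental. [folklore] -/
theorem block_nonempty {n : ℕ} (hn : 6 ≤ n) : (block n).Nonempty := by
  obtain ⟨p, hp, hlt, hle⟩ := Nat.exists_prime_lt_and_le_two_mul (2 ^ (n - 4)) (by positivity)
  have hp2 : p ≠ 2 := by
    rintro rfl
    have : 2 ^ 2 ≤ 2 ^ (n - 4) := Nat.pow_le_pow_right two_pos (by omega)
    omega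
  have hple : p < 2 ^ (n - 3) := by
    rcases hle.lt_or_eq with h | h
    · calc p < 2 * 2 ^ (n - 4) := h
        _ = 2 ^ (n - 3) := by rw [← pow_succ']; congr 1; omega
    · exfalso
      have h2 : p = 2 ^ (n - 4 + 1) := by rw [h, pow_succ']
      exact hp2 ((Nat.Prime.eq_one_or_self_of_dvd hp 2
        ⟨2 ^ (n - 4), by rw [h2, pow_succ']⟩).resolve_left (by norm_num)).symm
  refine ⟨8 * p, mem_block.mpr ⟨⟨?_, ?_⟩, isNegFund_eight_mul hp hp2⟩⟩
  · calc 2 ^ (n - 1) = 8 * 2 ^ (n - 4) := by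
          rw [show (8 : ℕ) = 2 ^ 3 by norm_num, ← pow_add]; congr 1; omega
      _ ≤ 8 * p := by omega
  · calc 8 * p < 8 * 2 ^ (n - 3) := by omega
      _ = 2 ^ n := by rw [show (8 : ℕ) = 2 ^ 3 by norm_num, ← pow_add]; congr 1; omega

/-- Every `d` in the block has its top bit `n − 1` set. [folklore] -/
theorem testBit_pred_of_mem_block {n d : ℕ} (hn : 1 ≤ n) (hd : d ∈ block n) :
    Nat.testBit d (n - 1) = true := by
  obtain ⟨⟨hlo, hhi⟩, -⟩ := mem_block.mp hd
  by_contra hbit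
  rw [Bool.not_eq_true] at hbit
  have : d < 2 ^ (n - 1) := by
    apply Nat.lt_pow_two_of_testBit
    intro i hi
    rcases Nat.lt_or_ge i n with hin | hin
    · have : i = n - 1 := by omega
      subst this
      exact hbit
    · exact Nat.testBit_lt_two_pow (hhi.trans_le (Nat.pow_le_pow_right two_pos hin))
  omega

/-- The top-digit half `b = true` is the whole block. [folklore] -/
theorem half_pred_true {n : ℕ} (hn : 1 ≤ n) : half n (n - 1) true = block n := by
  ext d
  rw [mem_half]
  exact ⟨fun h => h.1, fun h => ⟨h, testBit_pred_of_mem_block hn h⟩⟩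

/-- **`Pins` is load-bearing.** With the hypothesis dropped, `t := 0` violates the conclusion at
the top digit: `|Σ_{𝒟_n} (0 − 2)| = 2·#𝒟_n > 1·#𝒟_n` as soon as `𝒟_n ≠ ∅` (`n ≥ 6`). [folklore] -/
theorem digitRung_false_without_pins : ¬ DigitRungWithoutPins := by
  intro h
  have hev := h (fun _ => 0) 1 one_pos
  rw [Filter.eventually_atTop] at hev
  obtain ⟨N, hN⟩ := hev
  set n := max N 6 with hn
  have hn6 : 6 ≤ n := le_max_right _ _
  have key := hN n (le_max_left _ _) (n - 1) (by omega) true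
  unfold dev at key
  rw [half_pred_true (by omega)] at key
  simp only [Nat.cast_zero, zero_sub, Finset.sum_const, nsmul_eq_mul, mul_neg, one_mul,
    abs_neg] at key
  have hpos : (0 : ℝ) < (block n).card := by exact_mod_cast (block_nonempty hn6).card_pos
  rw [abs_of_pos (by positivity)] at key
  linarith

/-! ## §3 The top digit forces the Davenport–Heilbronn dyadic mean -/

/-- **DigitRung ⇒ dyadic Davenport–Heilbronn.** The case `j = n − 1`, `b = true` of the crux is
exactly "the mean of `#Cl₃(−d)` over `n`-bit fundamental `−d` tends to `2`", i.e. the imaginary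
half of BST Cor. 7 / Davenport–Heilbronn Thm 3 differenced over dyadic blocks. So the crux is at
least as strong as (dyadic) DH, which the tree holds only as the named fact
`bst_threeTorsion_mean`; and the centring constant `2` cannot be replaced by any other real
number (a version centred at `c ≠ 2` contradicts DH). [folklore] -/
theorem digitRung_implies_dyadicMeanTwo (h : DigitRung) :
    ∀ ε : ℝ, 0 < ε → ∀ᶠ n : ℕ in atTop,
      |∑ d ∈ block n, ((quadFieldThreeTorsion (-(d:ℤ)) : ℝ) - 2)| ≤ ε * ((block n).card : ℝ) := by
  intro ε hε
  have hc := (digitRung_iff_canonical.mp h) ε hε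
  filter_upwards [hc, Filter.eventually_ge_atTop 1] with n hn hn1
  have := hn (n - 1) (by omega) true
  rwa [dev, half_pred_true hn1] at this

/-- Contrapositive, the shape a disproof would take: exhibit `ε > 0` and infinitely many `n` with a
digit half whose centred `#Cl₃`-sum exceeds `ε·#𝒟_n`. By §1 only the canonical statistic matters.
[folklore] -/
theorem not_digitRung_iff :
    ¬ DigitRung ↔ ∃ ε : ℝ, 0 < ε ∧ ∃ᶠ n : ℕ in atTop, ∃ j < n, ∃ b : Bool,
      ε * ((block n).card : ℝ) < |dev quadFieldThreeTorsion n j b| := by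
  simp only [digitRung_iff_canonical, Concl, not_forall, Filter.not_eventually, not_le, exists_prop]

/-! ## §4 No 2-adic main-term bias at any digit depth (finite shadow) -/

/-- The discriminant of the binary cubic form `a x³ + b x² y + c x y² + d y³`. -/
def cubicDisc {R : Type*} [CommRing R] (a b c d : R) : R :=
  b ^ 2 * c ^ 2 - 4 * a * c ^ 3 - 4 * b ^ 3 * d - 27 * a ^ 2 * d ^ 2 + 18 * a * b * c * d

/-- `Disc(f(s x, y)) = s⁶ · Disc(f(x, y))`. [folklore] -/
theorem cubicDisc_scale {R : Type*} [CommRing R] (s a b c d : R) :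
    cubicDisc (s ^ 3 * a) (s ^ 2 * b) (s * c) d = s ^ 6 * cubicDisc a b c d := by
  unfold cubicDisc; ring

/-- The substitution `(x, y) ↦ (s x, y)` on coefficient quadruples. -/
def scale {R : Type*} [CommRing R] (s : R) (f : R × R × R × R) : R × R × R × R :=
  (s ^ 3 * f.1, s ^ 2 * f.2.1, s * f.2.2.1, f.2.2.2)

/-- `scale s⁻¹ ∘ scale s = id`. [folklore] -/
theorem scale_scale_inv {R : Type*} [CommRing R] (s : Rˣ) (f : R × R × R × R) :
    scale (↑s⁻¹ : R) (scale (↑s : R) f) = f := by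
  obtain ⟨a, b, c, d⟩ := f
  simp only [scale, Prod.mk.injEq]
  refine ⟨?_, ?_, ?_, trivial⟩
  · rw [← mul_assoc, ← mul_pow, Units.inv_mul, one_pow, one_mul]
  · rw [← mul_assoc, ← mul_pow, Units.inv_mul, one_pow, one_mul]
  · rw [← mul_assoc, Units.inv_mul, one_mul]

/-- `scale s ∘ scale s⁻¹ = id`. [folklore] -/
theorem scale_inv_scale {R : Type*} [CommRing R] (s : Rˣ) (f : R × R × R × R) :
    scale (↑s : R) (scale (↑s⁻¹ : R) f) = f := by
  simpa using scale_scale_inv s⁻¹ f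

/-- **Discriminant counts are invariant under unit sixth powers.** For every unit `s` of a finite
commutative ring `R` (e.g. `ZMod (2^k)`) and every `r`, the binary cubic forms over `R` with
discriminant `r` are in bijection with those of discriminant `s⁶ r`, by `(x, y) ↦ (s x, y)`.
Over `ℤ/2ᵏ` (`k ≥ 3`) the sixth powers of units are exactly the units `≡ 1 (mod 8)`, so the count
depends on a unit `r` only through `r mod 8`: the distribution of `Disc mod 2ᵏ` carries no
information at binary digits `≥ 3` beyond the 2-adic square class. Since `(x, y) ↦ (s x, y)` is a
`GL₂`-change of variables, the same holds for the sub-counts of forms whose cubic ring is maximal /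
not totally ramified at `2` — the local content of the planner's "mean 2 in every class mod 2^{j+1}".
[folklore] -/
theorem card_cubicDisc_eq_mul_unit_pow_six {R : Type*} [CommRing R] [Fintype R] [DecidableEq R]
    (s : Rˣ) (r : R) :
    (Finset.univ.filter fun f : R × R × R × R => cubicDisc f.1 f.2.1 f.2.2.1 f.2.2.2 = r).card =
      (Finset.univ.filter fun f : R × R × R × R =>
        cubicDisc f.1 f.2.1 f.2.2.1 f.2.2.2 = (s : R) ^ 6 * r).card := by
  refine Finset.card_nbij' (scale (↑s : R)) (scale (↑s⁻¹ : R)) (fun f hf => ?_) (fun f hf => ?_)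
    (fun f _ => scale_scale_inv s f) (fun f _ => scale_inv_scale s f)
  · simp only [Finset.mem_coe, Finset.mem_filter, Finset.mem_univ, true_and] at hf ⊢
    rw [scale, cubicDisc_scale, hf]
  · simp only [Finset.mem_coe, Finset.mem_filter, Finset.mem_univ, true_and] at hf ⊢
    rw [scale, cubicDisc_scale, hf, ← mul_assoc, ← mul_pow, Units.inv_mul, one_pow, one_mul]

/-- The sixth powers of the odd residues mod `64` are exactly the residues `≡ 1 (mod 8)` (checked
by `decide`; the same holds mod every `2ᵏ`, `k ≥ 3`, since `(ℤ/2ᵏ)ˣ ≅ C₂ × C_{2^{k-2}}` and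
`x ↦ x³` is bijective on a 2-group). With `card_cubicDisc_eq_mul_unit_pow_six`: the number of
binary cubic forms mod `64` of discriminant `a` is the same for all odd `a` in a class mod `8`.
[folklore] -/
theorem pow_six_odd_mod_64 :
    (∀ s : Fin 64, s.val % 2 = 1 → s.val ^ 6 % 64 % 8 = 1) ∧
      (∀ u : Fin 64, u.val % 8 = 1 → ∃ s : Fin 64, s.val % 2 = 1 ∧ s.val ^ 6 % 64 = u.val) := by
  refine ⟨by decide +kernel, by decide +kernel⟩

/-! ## §4b Exact 2-adic balance of EVERY binary digit of the discriminant (all depths `k`) -/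

/-- `Disc(s⁻¹·f(sx, y)) = s²·Disc(f)`: the substitution `(a,b,c,d) ↦ (s²a, sb, c, s⁻¹d)` scales the
discriminant by `s²` (for a unit `s`). [folklore] -/
theorem cubicDisc_twist {R : Type*} [CommRing R] (s : Rˣ) (a b c d : R) :
    cubicDisc ((s : R) ^ 2 * a) ((s : R) * b) c ((↑s⁻¹ : R) * d) = (s : R) ^ 2 * cubicDisc a b c d := by
  have h : (s : R) * (↑s⁻¹ : R) = 1 := Units.mul_inv s
  unfold cubicDisc
  have e1 : ((s : R) * b) ^ 3 * ((↑s⁻¹ : R) * d) = (s : R) ^ 2 * (b ^ 3 * d) := by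
    calc ((s : R) * b) ^ 3 * ((↑s⁻¹ : R) * d) = (s : R) ^ 2 * ((s : R) * (↑s⁻¹ : R)) * (b ^ 3 * d) := by ring
      _ = (s : R) ^ 2 * (b ^ 3 * d) := by rw [h, mul_one]
  have e2 : ((s : R) ^ 2 * a) ^ 2 * ((↑s⁻¹ : R) * d) ^ 2 = (s : R) ^ 2 * (a ^ 2 * d ^ 2) := by
    calc ((s : R) ^ 2 * a) ^ 2 * ((↑s⁻¹ : R) * d) ^ 2
        = (s : R) ^ 2 * ((s : R) * (↑s⁻¹ : R)) ^ 2 * (a ^ 2 * d ^ 2) := by ring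
      _ = (s : R) ^ 2 * (a ^ 2 * d ^ 2) := by rw [h, one_pow, mul_one]
  have e3 : (s : R) ^ 2 * a * ((s : R) * b) * c * ((↑s⁻¹ : R) * d) = (s : R) ^ 2 * (a * b * c * d) := by
    calc (s : R) ^ 2 * a * ((s : R) * b) * c * ((↑s⁻¹ : R) * d)
        = (s : R) ^ 2 * ((s : R) * (↑s⁻¹ : R)) * (a * b * c * d) := by ring
      _ = (s : R) ^ 2 * (a * b * c * d) := by rw [h, mul_one]
  calc ((s : R) * b) ^ 2 * c ^ 2 - 4 * ((s : R) ^ 2 * a) * c ^ 3 - 4 * ((s : R) * b) ^ 3 * ((↑s⁻¹ : R) * d)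
        - 27 * ((s : R) ^ 2 * a) ^ 2 * ((↑s⁻¹ : R) * d) ^ 2
        + 18 * ((s : R) ^ 2 * a) * ((s : R) * b) * c * ((↑s⁻¹ : R) * d)
      = ((s : R) * b) ^ 2 * c ^ 2 - 4 * ((s : R) ^ 2 * a) * c ^ 3
        - 4 * (((s : R) * b) ^ 3 * ((↑s⁻¹ : R) * d))
        - 27 * (((s : R) ^ 2 * a) ^ 2 * ((↑s⁻¹ : R) * d) ^ 2)
        + 18 * ((s : R) ^ 2 * a * ((s : R) * b) * c * ((↑s⁻¹ : R) * d)) := by ring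
    _ = (s : R) ^ 2 * (b ^ 2 * c ^ 2 - 4 * a * c ^ 3 - 4 * b ^ 3 * d - 27 * a ^ 2 * d ^ 2
        + 18 * a * b * c * d) := by rw [e1, e2, e3]; ring

/-- The substitution `(a, b, c, d) ↦ (s²a, sb, c, s⁻¹d)` on coefficient quadruples. -/
def twist {R : Type*} [CommRing R] (s : Rˣ) (f : R × R × R × R) : R × R × R × R :=
  ((s : R) ^ 2 * f.1, (s : R) * f.2.1, f.2.2.1, (↑s⁻¹ : R) * f.2.2.2)

/-- `twist s⁻¹ ∘ twist s = id`. [folklore] -/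
theorem twist_inv_twist {R : Type*} [CommRing R] (s : Rˣ) (f : R × R × R × R) :
    twist s⁻¹ (twist s f) = f := by
  obtain ⟨a, b, c, d⟩ := f
  simp only [twist, inv_inv, Prod.mk.injEq]
  refine ⟨?_, ?_, trivial, ?_⟩
  · rw [← mul_assoc, ← mul_pow, Units.inv_mul, one_pow, one_mul]
  · rw [← mul_assoc, Units.inv_mul, one_mul]
  · rw [← mul_assoc, Units.mul_inv, one_mul]

/-- `twist s ∘ twist s⁻¹ = id`. [folklore] -/
theorem twist_twist_inv {R : Type*} [CommRing R] (s : Rˣ) (f : R × R × R × R) :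
    twist s (twist s⁻¹ f) = f := by
  simpa using twist_inv_twist s⁻¹ f

/-- In a twist-stable family, discriminant `r` and discriminant `s²·r` are equinumerous. [folklore] -/
theorem card_cubicDisc_eq_mul_unit_sq {R : Type*} [CommRing R] [DecidableEq R]
    (M : Finset (R × R × R × R)) (hM : ∀ (s : Rˣ), ∀ f ∈ M, twist s f ∈ M) (s : Rˣ) (r : R) :
    (M.filter fun f => cubicDisc f.1 f.2.1 f.2.2.1 f.2.2.2 = r).card =
      (M.filter fun f => cubicDisc f.1 f.2.1 f.2.2.1 f.2.2.2 = (s : R) ^ 2 * r).card := by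
  refine Finset.card_nbij' (twist s) (twist s⁻¹) (fun f hf => ?_) (fun f hf => ?_)
    (fun f _ => twist_inv_twist s f) (fun f _ => twist_twist_inv s f)
  · simp only [Finset.mem_coe, Finset.mem_filter] at hf ⊢
    refine ⟨hM s f hf.1, ?_⟩
    rw [twist, cubicDisc_twist, hf.2]
  · simp only [Finset.mem_coe, Finset.mem_filter] at hf ⊢
    refine ⟨hM s⁻¹ f hf.1, ?_⟩
    rw [twist, cubicDisc_twist, hf.2, ← mul_assoc, ← mul_pow, Units.inv_mul, one_pow, one_mul]

/-- `9^{2^j} = 1 + 2^{j+3} + 2^{j+4}·t` for some `t` (the 2-adic logarithm of `9` has valuation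
exactly `3`). [folklore] -/
theorem nine_pow_two_pow (j : ℕ) : ∃ t : ℕ, 9 ^ 2 ^ j = 1 + 2 ^ (j + 3) + 2 ^ (j + 4) * t := by
  induction j with
  | zero => exact ⟨0, by norm_num⟩
  | succ j ih =>
    obtain ⟨t, ht⟩ := ih
    refine ⟨t + t ^ 2 * 2 ^ (j + 3) + 2 ^ (j + 1) + t * 2 ^ (j + 3), ?_⟩
    rw [pow_succ, pow_mul, ht]
    ring

/-- In `ℤ/2ᵏ`: `9^{2^{k-4-v}} · 2ᵛ = 2ᵛ + 2^{k-1}` for `v + 4 ≤ k`. [folklore] -/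
theorem nine_pow_mul_two_pow_zmod {k v : ℕ} (hk : v + 4 ≤ k) :
    ((9 : ZMod (2 ^ k)) ^ 2 ^ (k - 4 - v)) * 2 ^ v = 2 ^ v + 2 ^ (k - 1) := by
  obtain ⟨t, ht⟩ := nine_pow_two_pow (k - 4 - v)
  have hnat : 9 ^ 2 ^ (k - 4 - v) * 2 ^ v = 2 ^ v + 2 ^ (k - 1) + 2 ^ k * t := by
    rw [ht]
    have h1 : k - 4 - v + 3 + v = k - 1 := by omega
    have h2 : k - 4 - v + 4 + v = k := by omega
    calc (1 + 2 ^ (k - 4 - v + 3) + 2 ^ (k - 4 - v + 4) * t) * 2 ^ v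
        = 2 ^ v + 2 ^ (k - 4 - v + 3 + v) + 2 ^ (k - 4 - v + 4 + v) * t := by ring
      _ = 2 ^ v + 2 ^ (k - 1) + 2 ^ k * t := by rw [h1, h2]
  have h0 : (2 : ZMod (2 ^ k)) ^ k = 0 := by
    have := ZMod.natCast_self (2 ^ k)
    push_cast at this
    exact this
  have := congrArg (fun n : ℕ => (n : ZMod (2 ^ k))) hnat
  simp only [Nat.cast_mul, Nat.cast_pow, Nat.cast_add, Nat.cast_ofNat] at this
  rwa [h0, zero_mul, add_zero] at this

/-- **Exact 2-adic balance of every binary digit of the discriminant.** Let `M` be a family of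
binary cubic forms over `ℤ/2ᵏ` stable under the substitutions `(a,b,c,d) ↦ (s²a, sb, c, s⁻¹d)`
(`s` a unit) — e.g. all forms, or the reductions of the forms whose cubic algebra over `ℤ₂` lies in
any isomorphism-stable class (maximal, nowhere totally ramified, given splitting type). Then for
every residue `a = 2ᵛ·a₁` with `a₁` odd and `k ≥ v + 4`, the forms in `M` with discriminant `a`
and those with discriminant `a + 2^{k-1}` are equinumerous: digit `k − 1` of `Disc` is exactly
fair given the lower digits. For maximal nowhere-totally-ramified algebras `v ≤ 3`, so this covers
every digit `≥ 7`; it is the vanishing of the singular series of `Σ_f e(r·Disc f/2ᵏ)`, `r` odd.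
[folklore] -/
theorem card_cubicDisc_eq_add_two_pow {k v : ℕ} (hk : v + 4 ≤ k)
    (M : Finset (ZMod (2 ^ k) × ZMod (2 ^ k) × ZMod (2 ^ k) × ZMod (2 ^ k)))
    (hM : ∀ (s : (ZMod (2 ^ k))ˣ), ∀ f ∈ M, twist s f ∈ M)
    (a₁ : ZMod (2 ^ k)) (ha₁ : ∃ q : ZMod (2 ^ k), a₁ = 2 * q + 1) :
    (M.filter fun f => cubicDisc f.1 f.2.1 f.2.2.1 f.2.2.2 = 2 ^ v * a₁).card =
      (M.filter fun f => cubicDisc f.1 f.2.1 f.2.2.1 f.2.2.2 = 2 ^ v * a₁ + 2 ^ (k - 1)).card := by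
  -- the unit `3` and `s = 3^{2^{k-4-v}}`, `s² = 9^{2^{k-4-v}}`
  have h3 : Nat.Coprime 3 (2 ^ k) := Nat.Coprime.pow_right k (by norm_num)
  set u : (ZMod (2 ^ k))ˣ := ZMod.unitOfCoprime 3 h3 with hu
  set s : (ZMod (2 ^ k))ˣ := u ^ 2 ^ (k - 4 - v) with hs
  have hs2 : (s : ZMod (2 ^ k)) ^ 2 = (9 : ZMod (2 ^ k)) ^ 2 ^ (k - 4 - v) := by
    rw [hs, Units.val_pow_eq_pow_val, hu, ZMod.coe_unitOfCoprime, ← pow_mul, mul_comm, pow_mul]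
    norm_num
  rw [card_cubicDisc_eq_mul_unit_sq M hM s (2 ^ v * a₁)]
  congr 1
  ext f
  simp only [Finset.mem_filter]
  rw [hs2, ← mul_assoc, nine_pow_mul_two_pow_zmod hk, add_mul]
  obtain ⟨q, rfl⟩ := ha₁
  have h2k : (2 : ZMod (2 ^ k)) ^ (k - 1) * 2 = 0 := by
    rw [← pow_succ, show k - 1 + 1 = k by omega]
    have := ZMod.natCast_self (2 ^ k)
    push_cast at this
    exact this
  have : (2 : ZMod (2 ^ k)) ^ (k - 1) * (2 * q + 1) = 2 ^ (k - 1) := by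
    rw [mul_add, mul_one, ← mul_assoc, h2k, zero_mul, zero_add]
  rw [this]


/-! ## §5 Equivalent Walsh form; the conclusion fails for unstructured test sets -/

/-- The digital Walsh character of weight one, `w_j(d) = (−1)^{bit_j(d)}`. -/
def walshSign (j d : ℕ) : ℝ := if Nat.testBit d j then -1 else 1

/-- The weight-one Walsh correlation `C_t(n, j) = Σ_{d ∈ 𝒟_n} (t(−d) − 2)·(−1)^{bit_j d}`. -/
def walsh (t : ℤ → ℕ) (n j : ℕ) : ℝ :=
  ∑ d ∈ block n, ((t (-(d:ℤ)) : ℝ) - 2) * walshSign j d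

/-- The block mean deviation `Σ_{d ∈ 𝒟_n} (t(−d) − 2)`. -/
def total (t : ℤ → ℕ) (n : ℕ) : ℝ := ∑ d ∈ block n, ((t (-(d:ℤ)) : ℝ) - 2)

/-- The block deviation splits over the two digit halves. [folklore] -/
theorem total_eq_dev_add_dev (t : ℤ → ℕ) (n j : ℕ) :
    total t n = dev t n j false + dev t n j true := by
  unfold total dev half
  rw [← Finset.sum_filter_add_sum_filter_not (block n) (fun d => Nat.testBit d j = false)]
  congr 1
  refine Finset.sum_congr (Finset.filter_congr fun d _ => ?_) fun _ _ => rfl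
  cases Nat.testBit d j <;> simp

/-- The Walsh correlation is the difference of the two digit-half deviations. [folklore] -/
theorem walsh_eq_dev_sub_dev (t : ℤ → ℕ) (n j : ℕ) :
    walsh t n j = dev t n j false - dev t n j true := by
  unfold walsh dev half
  rw [← Finset.sum_filter_add_sum_filter_not (block n) (fun d => Nat.testBit d j = false)]
  rw [sub_eq_add_neg, ← Finset.sum_neg_distrib]
  congr 1
  · refine Finset.sum_congr rfl fun d hd => ?_
    have hb : Nat.testBit d j = false := (Finset.mem_filter.mp hd).2
    simp [walshSign, hb]
  · refine Finset.sum_congr (Finset.filter_congr fun d _ => ?_) fun d hd => ?_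
    · cases Nat.testBit d j <;> simp
    · have hb : Nat.testBit d j = true := (Finset.mem_filter.mp hd).2
      simp [walshSign, hb]

/-- **Walsh form of the rung.** For any statistic, the digit-half conclusion is equivalent to
"block mean deviation `o(#𝒟_n)`" (the top digit, §3) together with "weight-one digital Walsh
correlations `o(#𝒟_n)` uniformly in the position" — the `|S| = 1` case of the AC⁰ rung's
Fourier–Walsh programme (route item AcZeroRung; Green 2012 Prop. 1 is the Möbius analogue).
A disproof of DigitRung is therefore exactly a persistent weight-one Walsh bias of `#Cl₃`. [folklore] -/
theorem concl_iff_total_and_walsh (t : ℤ → ℕ) :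
    Concl t ↔
      (∀ ε : ℝ, 0 < ε → ∀ᶠ n : ℕ in atTop, |total t n| ≤ ε * ((block n).card : ℝ)) ∧
      (∀ ε : ℝ, 0 < ε → ∀ᶠ n : ℕ in atTop, ∀ j < n, |walsh t n j| ≤ ε * ((block n).card : ℝ)) := by
  constructor
  · intro h
    refine ⟨fun ε hε => ?_, fun ε hε => ?_⟩
    · filter_upwards [h ε hε, Filter.eventually_ge_atTop 1] with n hn hn1
      have := hn (n - 1) (by omega) true
      rwa [dev, half_pred_true hn1] at this
    · filter_upwards [h (ε / 2) (half_pos hε)] with n hn j hj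
      rw [walsh_eq_dev_sub_dev]
      have h0 := hn j hj false
      have h1 := hn j hj true
      calc |dev t n j false - dev t n j true| ≤ |dev t n j false| + |dev t n j true| := abs_sub _ _
        _ ≤ ε / 2 * ((block n).card : ℝ) + ε / 2 * ((block n).card : ℝ) := add_le_add h0 h1
        _ = ε * ((block n).card : ℝ) := by ring
  · rintro ⟨hT, hW⟩ ε hε
    filter_upwards [hT ε hε, hW ε hε] with n hn hw j hj b
    have hw' := hw j hj
    rw [walsh_eq_dev_sub_dev] at hw'
    rw [total_eq_dev_add_dev t n j] at hn
    have hcard : (0 : ℝ) ≤ ε * ((block n).card : ℝ) := by positivity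
    cases b
    · have : dev t n j false = (( dev t n j false + dev t n j true) +
          (dev t n j false - dev t n j true)) / 2 := by ring
      rw [this, abs_div, abs_two]
      calc |dev t n j false + dev t n j true + (dev t n j false - dev t n j true)| / 2
          ≤ (|dev t n j false + dev t n j true| + |dev t n j false - dev t n j true|) / 2 := by
            gcongr; exact abs_add_le _ _
        _ ≤ (ε * ((block n).card : ℝ) + ε * ((block n).card : ℝ)) / 2 := by gcongr
        _ = ε * ((block n).card : ℝ) := by ring
    · have : dev t n j true = (( dev t n j false + dev t n j true) -
          (dev t n j false - dev t n j true)) / 2 := by ring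
      rw [this, abs_div, abs_two]
      calc |dev t n j false + dev t n j true - (dev t n j false - dev t n j true)| / 2
          ≤ (|dev t n j false + dev t n j true| + |dev t n j false - dev t n j true|) / 2 := by
            gcongr; exact abs_sub _ _
        _ ≤ (ε * ((block n).card : ℝ) + ε * ((block n).card : ℝ)) / 2 := by gcongr
        _ = ε * ((block n).card : ℝ) := by ring

/-- `#Cl₃(D)` is a power of `3`, hence never `2`: every term of the centred sums has modulus `≥ 1`.
[folklore] -/
theorem one_le_abs_canonical_sub_two (D : ℤ) :
    (1 : ℝ) ≤ |((quadFieldThreeTorsion D : ℝ)) - 2| := by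
  obtain ⟨r, hr⟩ := exists_quadFieldThreeTorsion_eq_pow D
  rw [hr]
  rcases r with _ | r
  · norm_num
  · have h3 : (3 : ℝ) ≤ (3 : ℝ) ^ (r + 1) := by
      calc (3 : ℝ) = 3 ^ 1 := by norm_num
        _ ≤ 3 ^ (r + 1) := pow_le_pow_right₀ (by norm_num) (by omega)
    push_cast
    rw [abs_of_nonneg (by linarith)]
    linarith

/-- **Structure of the test set is essential.** For unstructured test sets `A ⊆ 𝒟_n` the
conclusion of the rung fails as badly as possible: for every `n` some `A` (namely `{t < 2}` or
`{t > 2}`, whichever carries more absolute deviation) has `|Σ_{A} (#Cl₃(−d) − 2)| ≥ #𝒟_n / 2`,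
because `#Cl₃ = 3^{r₃} ≠ 2` pointwise. So no argument that is insensitive to the shape of
`{bit_j = b}` (e.g. one using only `#half ≈ #𝒟_n/2`) can prove DigitRung, and the ladder can never
reach arbitrary (P/poly-style) test sets by statistics alone — the correlation bounds must use the
digit structure (residue classes / intervals / Bohr sets). [folklore] -/
theorem exists_subset_large_dev (n : ℕ) :
    ∃ A ⊆ block n, ((block n).card : ℝ) / 2 ≤
      |∑ d ∈ A, ((quadFieldThreeTorsion (-(d:ℤ)) : ℝ) - 2)| := by
  set f : ℕ → ℝ := fun d => ((quadFieldThreeTorsion (-(d:ℤ)) : ℝ) - 2) with hf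
  set Aneg := (block n).filter fun d => f d < 0 with hAneg
  set Apos := (block n).filter fun d => ¬ f d < 0 with hApos
  have hsum : ((block n).card : ℝ) ≤ |∑ d ∈ Aneg, f d| + |∑ d ∈ Apos, f d| := by
    have h1 : ((block n).card : ℝ) ≤ ∑ d ∈ block n, |f d| := by
      have : ∑ _d ∈ block n, (1 : ℝ) = (block n).card := by simp
      rw [← this]
      exact Finset.sum_le_sum fun d _ => one_le_abs_canonical_sub_two _
    have h2 : ∑ d ∈ block n, |f d| = ∑ d ∈ Aneg, |f d| + ∑ d ∈ Apos, |f d| :=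
      (Finset.sum_filter_add_sum_filter_not (block n) (fun d => f d < 0) _).symm
    have h3 : ∑ d ∈ Aneg, |f d| = |∑ d ∈ Aneg, f d| := by
      have hle : ∑ d ∈ Aneg, f d ≤ 0 :=
        Finset.sum_nonpos fun d hd => le_of_lt (Finset.mem_filter.mp hd).2
      rw [abs_of_nonpos hle, ← Finset.sum_neg_distrib]
      exact Finset.sum_congr rfl fun d hd => abs_of_neg (Finset.mem_filter.mp hd).2
    have h4 : ∑ d ∈ Apos, |f d| = |∑ d ∈ Apos, f d| := by
      have hge : ∀ d ∈ Apos, 0 ≤ f d := fun d hd => not_lt.mp (Finset.mem_filter.mp hd).2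
      rw [abs_of_nonneg (Finset.sum_nonneg hge)]
      exact Finset.sum_congr rfl fun d hd => abs_of_nonneg (hge d hd)
    linarith
  by_cases h : ((block n).card : ℝ) / 2 ≤ |∑ d ∈ Aneg, f d|
  · exact ⟨Aneg, Finset.filter_subset _ _, h⟩
  · refine ⟨Apos, Finset.filter_subset _ _, ?_⟩
    push Not at h
    linarith

/-! ## §6 State of the tools for the two ends (bookkeeping facts for whoever attacks the band) -/

/-- The tree's arithmetic-progression fact `tt_threeTorsion_sum_progression`
(ThreeTorsionMean.lean: Taniguchi–Thorne, Duke Thm 6) is stated only for `gcd(6a, m) = 1`; for the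
digit moduli `m = 2^{j+1}` this side condition NEVER holds (`6a` is even). So, contrary to a loose
reading of the grounder notes, the low-digit end `j ≤ (5/43 − δ)n` is not available in the tree even
as a named fact: it needs TT's general twisted theorem (Duke Thm 25) / the CJM "4 ∣ m" AP theorem,
plus the 2-adic mass computation of §4. [folklore] -/
theorem gcd_six_mul_two_pow_ne_one (a : ℤ) (j : ℕ) : Int.gcd (6 * a) (2 ^ (j + 1) : ℕ) ≠ 1 := by
  intro h
  have h6 : ((2 : ℕ) : ℤ) ∣ 6 * a := ⟨3 * a, by ring⟩
  have h2 : ((2 : ℕ) : ℤ) ∣ ((2 ^ (j + 1) : ℕ) : ℤ) := ⟨2 ^ j, by push_cast; ring⟩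
  have h22 : 2 ∣ Int.gcd (6 * a) (2 ^ (j + 1) : ℕ) := Int.dvd_gcd h6 h2
  rw [h] at h22
  norm_num at h22

/-! ## §7 The two printed ends do not imply the middle band: a `{1,3}`-valued model statistic -/

/-- Flip the binary digit `j`. -/
def flipBit (j d : ℕ) : ℕ := d ^^^ 2 ^ j

/-- Flipping a digit twice is the identity. [folklore] -/
theorem flipBit_flipBit (j d : ℕ) : flipBit j (flipBit j d) = d := by
  simp [flipBit]

/-- Digits of `flipBit j d`: digit `j` flipped, the others unchanged. [folklore] -/
theorem testBit_flipBit (j d i : ℕ) :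
    (flipBit j d).testBit i = (d.testBit i ^^ decide (j = i)) := by
  simp [flipBit, Nat.testBit_xor, Nat.testBit_two_pow]

/-- Flipping digit `j` reverses the sign `(−1)^{bit_j}`. [folklore] -/
theorem walshSign_flipBit (j d : ℕ) : walshSign j (flipBit j d) = -walshSign j d := by
  unfold walshSign
  rw [testBit_flipBit]
  cases d.testBit j <;> simp

/-- Flipping digit `j` does not change the residue mod `2^j` (the "low end" data)… -/
theorem flipBit_mod_two_pow (j d : ℕ) : flipBit j d % 2 ^ j = d % 2 ^ j := by
  apply Nat.eq_of_testBit_eq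
  intro i
  rw [Nat.testBit_mod_two_pow, Nat.testBit_mod_two_pow, testBit_flipBit]
  by_cases hi : i < j
  · have : decide (j = i) = false := decide_eq_false (by omega)
    rw [this, Bool.xor_false]
  · simp [hi]

/-- … nor the quotient by `2^{j+1}` (the "high end" data: which dyadic interval of length
`2^{j+1}` contains `d`). -/
theorem flipBit_div_two_pow (j d : ℕ) : flipBit j d / 2 ^ (j + 1) = d / 2 ^ (j + 1) := by
  apply Nat.eq_of_testBit_eq
  intro i
  rw [Nat.testBit_div_two_pow, Nat.testBit_div_two_pow, testBit_flipBit]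
  have : decide (j = i + (j + 1)) = false := decide_eq_false (by omega)
  rw [this, Bool.xor_false]

/-- Flipping a digit `j ≤ n − 2` keeps an `n`-bit number `n`-bit. -/
theorem flipBit_mem_Ico {n j d : ℕ} (hj : j + 2 ≤ n) (hd : d ∈ Finset.Ico (2 ^ (n - 1)) (2 ^ n)) :
    flipBit j d ∈ Finset.Ico (2 ^ (n - 1)) (2 ^ n) := by
  rw [Finset.mem_Ico] at hd ⊢
  obtain ⟨hlo, hhi⟩ := hd
  have htop : d.testBit (n - 1) = true := by
    by_contra hbit
    rw [Bool.not_eq_true] at hbit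
    have : d < 2 ^ (n - 1) := by
      apply Nat.lt_pow_two_of_testBit
      intro i hi
      rcases Nat.lt_or_ge i n with hin | hin
      · have : i = n - 1 := by omega
        subst this
        exact hbit
      · exact Nat.testBit_lt_two_pow (hhi.trans_le (Nat.pow_le_pow_right two_pos hin))
    omega
  constructor
  · apply Nat.ge_two_pow_of_testBit
    rw [testBit_flipBit, htop, show decide (j = n - 1) = false from decide_eq_false (by omega)]
    rfl
  · apply Nat.lt_pow_two_of_testBit
    intro i hi
    rw [testBit_flipBit, Nat.testBit_lt_two_pow (hhi.trans_le (Nat.pow_le_pow_right two_pos hi)),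
      show decide (j = i) = false from decide_eq_false (by omega)]
    rfl

/-- Sums of `(−1)^{bit_j}` over sets stable under flipping digit `j` vanish. [folklore] -/
theorem sum_walshSign_eq_zero {j : ℕ} {S : Finset ℕ} (hS : ∀ d ∈ S, flipBit j d ∈ S) :
    ∑ d ∈ S, walshSign j d = 0 := by
  have h : ∑ d ∈ S, walshSign j d = ∑ d ∈ S, walshSign j (flipBit j d) :=
    Finset.sum_nbij' (flipBit j) (flipBit j) hS hS (fun d _ => flipBit_flipBit j d)
      (fun d _ => flipBit_flipBit j d) (fun d _ => by rw [flipBit_flipBit])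
  simp only [walshSign_flipBit, Finset.sum_neg_distrib] at h
  linarith

/-- **The printed ends do not imply the middle.** For every block length `n` and every position
`j ≤ n − 2` there is a `{1, 3}`-valued statistic `t'` on the `n`-bit integers (so it "looks like"
`3^{r₃}`) whose centred sums vanish EXACTLY on every set defined without digit `j` — in particular
on every residue class mod `2ᵏ`, `k ≤ j` (the shape of the Taniguchi–Thorne AP input) and on every
dyadic interval of length `≥ 2^{j+1}` (the shape of the BST/BTT interval input) and on all their
Boolean combinations — while its digit-`j` Walsh correlation is maximal, `= 2^{n−1} = #block`.
Hence no argument can derive the digit-`j` rung from equidistribution data that does not itself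
involve digit `j`: the middle band needs a genuinely new input (cancellation in
`Σ_F e(r·Disc F / 2^{j+1})`), it is not an interpolation between the two ends. The same model with
`w_i w_j` in place of `w_j` separates the AC⁰ rung's `|S| = 2` level from DigitRung. [folklore] -/
theorem model_ends_hold_middle_fails (n j : ℕ) (hj : j + 2 ≤ n) :
    (∀ d : ℕ, (2 + walshSign j d = 1) ∨ (2 + walshSign j d = 3)) ∧
      (∀ P : ℕ → ℕ → Prop,
        ∑ d ∈ (Finset.Ico (2 ^ (n - 1)) (2 ^ n)).filter (fun d => P (d % 2 ^ j) (d / 2 ^ (j + 1))),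
          ((2 + walshSign j d) - 2) = 0) ∧
      ∑ d ∈ Finset.Ico (2 ^ (n - 1)) (2 ^ n), ((2 + walshSign j d) - 2) * walshSign j d
        = (2 : ℝ) ^ (n - 1) := by
  refine ⟨fun d => ?_, fun P => ?_, ?_⟩
  · unfold walshSign
    cases d.testBit j <;> norm_num
  · simp only [add_sub_cancel_left]
    apply sum_walshSign_eq_zero
    intro d hd
    rw [Finset.mem_filter] at hd ⊢
    exact ⟨flipBit_mem_Ico hj hd.1, by rw [flipBit_mod_two_pow, flipBit_div_two_pow]; exact hd.2⟩
  · have hsq : ∀ d : ℕ, ((2 + walshSign j d) - 2) * walshSign j d = 1 := by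
      intro d
      unfold walshSign
      cases d.testBit j <;> norm_num
    simp only [hsq, Finset.sum_const, Nat.card_Ico, nsmul_eq_mul, mul_one]
    have hn : 1 ≤ n := by omega
    have : 2 ^ n - 2 ^ (n - 1) = 2 ^ (n - 1) := by
      have h2 : 2 ^ n = 2 * 2 ^ (n - 1) := by
        rw [← pow_succ']; congr 1; omega
      omega
    rw [this]
    push_cast
    ring

/-! ## §8 Numerics (kill criterion (ii) of the route): per-digit Walsh bias of `#Cl₃`, `n ≤ 30`

`walsh(n, j) = (1/#𝒟_n) Σ_{d ∈ 𝒟_n} (t(−d) − 2)(−1)^{bit_j d}`; DigitRung ⇔ `walsh(n, j) → 0` uniformly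
in `j ≤ n − 2` together with `mean → 2` (§5). `sd = √(Var t / #𝒟_n)` = one standard deviation of
`walsh` under independent sampling; `z = walsh/sd`.

METHOD (evidence-grade; kit job j014094, 49 s on one core, artefacts `outputs/digits.txt`,
`tvalues_check.txt`, sha256 manifest attached to the item): EXACT values of `t(−d) = #Cl(−d)[3]`
for ALL fundamental `−d`, `d < 2^28` (81 594 634 fields), obtained WITHOUT class groups: by
Hasse / BST §8.5, `t(D) = 2·#{complex cubic fields of discriminant D} + 1`, and complex cubic
fields of discriminant `D` are in bijection with Mathews–Berwick–reduced irreducible integral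
binary cubic forms of discriminant `D` (Belabas, Math. Comp. 66 (1997), Lemma 4.2–4.4:
`d² − a² + ac − bd > 0`, `−(a−b)² − ac < ad − bc < (a+b)² + ac`, `a > 0`, `b ≥ 0`, `d > 0` if
`b = 0`); for FUNDAMENTAL `D` every cubic ring of discriminant `D` is maximal and primitive, so
every reduced form of discriminant `D` is irreducible and the count is exact. All 101 820 550
reduced forms with `|Disc| ≤ 2^28` were enumerated (O(X)); VALIDATED: (i) in-job self-test = exact
agreement with an independent pure-Python enumeration for all `|D| ≤ 2^16`; (ii) on the hub, all
19 933 fundamental `d < 2^16` agree with `#Cl[3]` computed from reduced binary QUADRATIC forms and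
Dirichlet composition (143 of them with `t = 9`); (iii) spot values `d = 23, 31, 47, 3299, 4027,
3896`. (The earlier PARI/`quadclassunit` jobs j008081, j009043/44/46/47 produced NO data — they were
scheduled on nodes without `gp`; their auto-attached `compute-*.json` evidence is void.)

```
 n      #D_n   mean t   E t^2  P(3|h)    sd      walsh(0)  walsh(0)*X^(1/6)  walsh(n-2)  max|walsh| 3<=j<=n-5 (j, z)   chi2/dof
 14       2490  1.7606  4.178  0.3719  0.02080   +0.0763      0.385          +0.0161     0.0378 ( 6, +1.8)        5.1/7
 15       4984  1.7829  4.517  0.3674  0.01639   +0.0626      0.354          -0.0116     0.0253 ( 4, -1.5)        5.6/8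
 16       9969  1.8157  4.701  0.3805  0.01187   +0.0545      0.346          -0.0103     0.0284 ( 7, +2.4)       11.4/9
 17      19905  1.8338  4.738  0.3917  0.00831   +0.0488      0.348          -0.0061     0.0195 (12, -2.4)       11.4/10
 18      39834  1.8477  4.827  0.3966  0.00596   +0.0410      0.328          -0.0008     0.0093 (12, -1.6)        6.4/11
 19      79704  1.8670  4.998  0.4004  0.00436   +0.0419      0.376          -0.0016     0.0089 ( 7, -2.0)       11.5/12
 20     159355  1.8813  5.075  0.4063  0.00310   +0.0352      0.355          -0.0033     0.0078 (15, -2.5)       18.2/13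
 21     318720  1.8940  5.169  0.4099  0.00223   +0.0304      0.344          -0.0019     0.0041 ( 9, +1.9)       10.5/14
 22     637464  1.9059  5.262  0.4132  0.00160   +0.0286      0.363          -0.0027     0.0029 ( 7, +1.8)       11.7/15
 23    1274904  1.9165  5.338  0.4165  0.00114   +0.0242      0.345          -0.0022     0.0022 (10, -2.0)       13.5/16
 24    2549853  1.9249  5.398  0.4192  0.00081   +0.0216      0.346          -0.0018     0.0013 (15, -1.6)       17.0/17
 25    5099663  1.9333  5.464  0.4215  0.00058   +0.0196      0.353          -0.0016     0.0012 (16, -2.1)       20.3/18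
 26   10199281  1.9406  5.523  0.4235  0.00042   +0.0173      0.349          -0.0015     0.0006 (13, -1.6)       13.6/19
 27   20398695  1.9471  5.571  0.4255  0.00030   +0.0152      0.345          -0.0016     0.0006 ( 9, -2.0)       16.9/20
 28   40797323  1.9528  5.618  0.4270  0.00021   +0.0138      0.350          -0.0013     0.0004 (17, +2.0)       16.3/21
 29   81594582  1.9579  5.657  0.4285  0.00015   +0.0122      0.347          -0.0012     0.0003 (15, -1.9)       21.1/22   [j014095]
 30  163189188  1.9626  5.695  0.4297  0.00011   +0.0109      0.348          -0.0010     0.0002 (24, -1.6)       14.5/23   [j014095]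
```

READING. (1) The ONLY structured biases are the two printed ends: `walsh(0)` (= `walsh(1)`: odd
vs even `d`, i.e. the 2-adic type of `ℚ(√−d)`) equals `(0.35 ± 0.03)·X^{−1/6}` at EVERY `n` — a
textbook `X^{5/6}` secondary-term effect with type-dependent density (BST/TT; Roberts), `o(1)`;
and the top digits carry the interval secondary-term drift `walsh(n−2) ≈ −1.5·10⁻³`,
`walsh(n−3) ≈ −8·10⁻⁴` at `n = 26–28` (also `O(X^{−1/6})`). (2) In the genuine middle band
`3 ≤ j ≤ n − 5` the correlations are PURE NOISE: `χ² ≈ dof` at every `n`, `max |z| ≤ 2.5`, and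
`max_j |walsh(30, j)| = 2·10⁻⁴` over 1.63·10⁸ fields (rows 29–30: job j014095, 4.1·10⁸ forms,
157 s) — any middle-digit bias of `#Cl₃` at `X ≈ 10⁹` is below `5·10⁻⁴` absolute, i.e. below 2 %
of the secondary-term scale `X^{−1/6}`.
(3) `mean t = 1.953`, `E t² = 5.62 → 6`, `P(3 ∣ h) = 0.427 → 0.4399` drift as Cohen–Lenstra +
secondary terms predict. VERDICT of kill criterion (ii): NO suspect-false signal; the data are
exactly what DigitRung + the known secondary terms predict. (Job for `n ≤ 32` running: j014140; same script `jobs/cubic/cubiccount.py` in the refuter folder.)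
-/

end Summit.QuantumAdvantage.QuantumAdvantage.Cruxes.DigitRung.Disproof

end
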